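import Summits.QuantumAdvantage.QuantumAdvantage.Theorems.CubicForrelationNearExactIsExactTwelveZ512PiBound

/-!
# Crux `CubicForrelation.NearExactIsExact` (stmt-QuantumAdvantage-14043) — n = 12, level-`≥ 6` side with `#Z = 768` on the OPEN window:
  the signed indicator has character sums in `128ℤ` and the perturbation has energy `≤ 254` — WHATEVER THE PARTNER

Certificate seat `b2b-cforr-cert` (gen 27).  HONEST FRAMING: a finite-slice lemma (standard axioms) about cubic Boolean pairs on 12 bits: the
partner-free core of gen 26's `tzd_Z768_div4_false` (which finished with a level-`≥ 6` partner), extracted so that type-O and level-5 partners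
can be excluded by Parseval (…TwelveLevelSixWindowDead).  NO value of `θ₁₂` is claimed; NOT summit progress.

Setting.  Cubic `f, g` on 12 bits, `W_g = 64u''`, `e := u'' − (−1)^f`, `Z := {u'' even}` with `#Z = 768`, `4 ∣ e` off `Z` (automatic on the
window by gen 26's `tzo_off_div4_le127`), `57/64 < Φ` (`B := Σe² ≤ 895`).  `σ := e mod 4 ∈ {±1}` on `Z`, `S := σ·1_Z`, `π := e − S ∈ 4ℤ`.
* `tzq_Z768_core`: (i) `Ŝ(y) ∈ 128ℤ` for EVERY `y` (gen 25/26's machine: 5-flat congruence for `S`, fibres of the period group, the transversal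
  identity `tzs_transversal`, affine fibre patterns `tba_affine`, coset sums `tbd_coset_sum`); (ii) `Σ π² ≤ 254` (pointwise `π² ≤ 2(e² − 1)` on
  `Z`, `π² = e²` off `Z`, and `Σ(e² − 1_Z) = B − 768 ≤ 127`).
Use (next file): `π̂ = ê − Ŝ = 64(−1)^g − W_f − Ŝ`; a type-O partner (`W_f/16` odd) makes `|π̂| ≥ 16` everywhere (`Σπ² ≥ 256`), a level-5
partner makes `|π̂| ≥ 32` on `≥ 2048` frequencies (`Σπ² ≥ 512`): both contradict (ii).

References: MacWilliams–Sloane (1977) Ch. 13 §3, Ch. 15; R. O'Donnell (2014) §1.4, §3.3.  Axioms: the standard three.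
-/

set_option linter.dupNamespace false -- D-0017: single-problem summit ⇒ `QuantumAdvantage.QuantumAdvantage` by design

noncomputable section

namespace Summit.QuantumAdvantage.QuantumAdvantage.Theorems.CubicForrelation.NearExactIsExact

open Finset
open Literature.Computability.QuantumComplexity
open Literature.Computability.QuantumComplexity.BuzetChailloux (bxor zeroVec bxor_bxor_cancel_left bxor_zeroVec zeroVec_bxor bxor_comm
  bxor_self)
open Literature.Computability.QuantumComplexity.DerivativeWalsh (W)

/-- **Partner-free core of the `#Z = 768` configuration** (module docstring): with `S` the signed indicator (`S = sZ [4 ∣ e + 1]` on `Z`, `0` off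
`Z`), every character sum `Σ_x S(x)(−1)^{x·y}` lies in `128ℤ`, and `Σ_x (e − S)² ≤ 254`.  Finite-slice statement, NOT summit progress.
[this work] -/
theorem tzq_Z768_core (f g : (Fin (6 + 6) → Bool) → Bool) (hf : IsDegLeFun 3 f) (hg : IsDegLeFun 3 g)
    (u'' : (Fin (6 + 6) → Bool) → ℤ) (hu'' : ∀ x, W (fun y => signOf (g y)) x = (2 : ℝ) ^ 6 * (u'' x : ℝ))
    (h768 : #(univ.filter fun x : Fin (6 + 6) → Bool => ¬ Odd (u'' x)) = 768)
    (h4off : ∀ y, y ∉ (univ.filter fun x : Fin (6 + 6) → Bool => ¬ Odd (u'' x)) → (4 : ℤ) ∣ u'' y - sZ (f y))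
    (hlo : (57 / 64 : ℝ) < forrelation f g)
    (S : (Fin (6 + 6) → Bool) → ℤ)
    (hSZ : ∀ x ∈ (univ.filter fun x : Fin (6 + 6) → Bool => ¬ Odd (u'' x)), S x = sZ (decide ((4 : ℤ) ∣ u'' x - sZ (f x) + 1)))
    (hS0 : ∀ y, y ∉ (univ.filter fun x : Fin (6 + 6) → Bool => ¬ Odd (u'' x)) → S y = 0) :
    (∀ y, ∃ K : ℤ, ∑ x, ((S x : ℤ) : ℝ) * twist x y = 128 * K) ∧
      (∑ x, (u'' x - sZ (f x) - S x) ^ 2 : ℤ) ≤ 254 := by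
  classical
  set Z := univ.filter (fun x : Fin (6 + 6) → Bool => ¬ Odd (u'' x)) with hZdef
  set P := (univ.filter fun a : Fin (6 + 6) → Bool => ∀ x, decide (Odd (u'' (bxor x a))) = decide (Odd (u'' x))) with hPdef
  have hmemZ : ∀ x, x ∈ Z ↔ ¬ Odd (u'' x) := fun x => by simp [hZdef]
  set e : (Fin (6 + 6) → Bool) → ℤ := fun x => u'' x - sZ (f x) with hedef
  have h4off' : ∀ y, y ∉ Z → (4 : ℤ) ∣ e y := h4off
  -- the budget `B = Σ e² ≤ 895`
  obtain ⟨hBR, heodd, hoffle⟩ := tzw_budget_split f g u'' hu''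
  have heodd' : ∀ x ∈ Z, Odd (e x) := fun x hx => heodd x hx
  have hB : (∑ x, e x ^ 2 : ℤ) ≤ 895 := by
    have h' : ((∑ x, e x ^ 2 : ℤ) : ℝ) < 896 := by rw [hBR]; linarith
    have h'' : (∑ x, e x ^ 2 : ℤ) < 896 := by exact_mod_cast h'
    omega
  -- the sign bit `β` on `Z`
  set β : (Fin (6 + 6) → Bool) → Bool := fun x => decide ((4 : ℤ) ∣ e x + 1) with hβdef
  have hβ : ∀ x ∈ Z, S x = sZ (β x) := fun x hx => hSZ x hx
  have hoff0 : ∀ y, y ∉ Z → S y = 0 := hS0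
  -- `π = e − S ∈ 4ℤ`
  have hπ4 : ∀ x, (4 : ℤ) ∣ e x - S x := by
    intro x
    by_cases hx : x ∈ Z
    · have hodd := Int.odd_iff.1 (heodd' x hx)
      by_cases h1 : (4 : ℤ) ∣ e x + 1
      · have hb : β x = true := by simp only [β]; exact decide_eq_true h1
        rw [hβ x hx, hb, show sZ true = -1 from rfl, sub_neg_eq_add]
        exact h1
      · have hb : β x = false := by simp only [β]; exact decide_eq_false h1
        rw [hβ x hx, hb, show sZ false = 1 from rfl]
        omega
    · rw [hoff0 x hx, sub_zero]; exact h4off' x hx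
  -- every parametrised 5-flat sum of `S` is `≡ 0 (mod 4)`
  have hS5 : ∀ (b : Fin (6 + 6) → Bool) (a : Fin 5 → Fin (6 + 6) → Bool),
      (4 : ℤ) ∣ ∑ ε : Fin 5 → Bool, S (fun j => b j ^^ decide (Odd #(univ.filter fun i => ε i && a i j))) := by
    intro b a
    have h5 : (4 : ℤ) ∣ ∑ ε : Fin 5 → Bool, e (fun j => b j ^^ decide (Odd #(univ.filter fun i => ε i && a i j))) :=
      gh_flat5 f g hf hg u'' hu'' b a
    have hsplit : ∑ ε : Fin 5 → Bool, S (fun j => b j ^^ decide (Odd #(univ.filter fun i => ε i && a i j))) =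
        ∑ ε : Fin 5 → Bool, e (fun j => b j ^^ decide (Odd #(univ.filter fun i => ε i && a i j))) -
        ∑ ε : Fin 5 → Bool, (e (fun j => b j ^^ decide (Odd #(univ.filter fun i => ε i && a i j))) -
          S (fun j => b j ^^ decide (Odd #(univ.filter fun i => ε i && a i j)))) := by
      rw [← sum_sub_distrib]; exact sum_congr rfl fun ε _ => by ring
    rw [hsplit]
    exact dvd_sub h5 (dvd_sum fun ε _ => hπ4 _)
  refine ⟨fun y => ?_, ?_⟩
  · -- (i) `Ŝ(y) ∈ 128ℤ`: fibres, the transversal identity, affine sign patterns, coset sums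
    obtain ⟨m₁, m₂, m₃, m₄, m₅, m₆, ⟨hm₁, hm₂, hm₃, hm₄, hm₅, hm₆⟩, hdist, hcov⟩ := tbc_fibres g hg u'' hu'' h768
    obtain ⟨hA, hstar⟩ := tzs_transversal g hg u'' hu'' h768 S hS5 β hβ hoff0 m₁ m₂ m₃ m₄ m₅ m₆ hm₁ hm₂ hm₃ hm₄ hm₅ hm₆ hdist hcov
    have hP0 : zeroVec ∈ P := tbc_P_zero u''
    have hPadd : ∀ a ∈ P, ∀ b ∈ P, bxor a b ∈ P := tbc_P_add u''
    have hZst : ∀ x ∈ Z, ∀ a ∈ P, bxor x a ∈ Z := fun x hx a ha => tbc_Z_stable u'' hx ha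
    have hP : #P = 128 := tbc_card_P g hg u'' hu'' h768
    obtain ⟨T, hT⟩ : ∃ T : Fin (6 + 6) → Bool, T = bxor (bxor (bxor (bxor m₁ m₂) m₃) m₄) m₅ := ⟨_, rfl⟩
    have hA' : bxor T m₆ ∈ P := by rw [hT]; exact hA
    have haff := tba_affine P hP0 hPadd β m₁ m₂ m₃ m₄ m₅ T (by rw [hT]; exact hstar)
    set M' := ({m₁, m₂, m₃, m₄, m₅, T} : Finset (Fin (6 + 6) → Bool)) with hM'
    have hTZ : T ∈ Z := by
      have h := hZst _ hm₆ _ (show bxor m₆ T ∈ P by rw [bxor_comm]; exact hA')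
      rwa [bxor_bxor_cancel_left] at h
    have hM'Z : ∀ a ∈ M', a ∈ Z := by
      intro a ha
      simp only [hM', mem_insert, mem_singleton] at ha
      rcases ha with rfl | rfl | rfl | rfl | rfl | rfl <;> assumption
    have d12 := hdist m₁ m₂ (by simp); have d13 := hdist m₁ m₃ (by simp); have d14 := hdist m₁ m₄ (by simp)
    have d15 := hdist m₁ m₅ (by simp); have d23 := hdist m₂ m₃ (by simp); have d24 := hdist m₂ m₄ (by simp)
    have d25 := hdist m₂ m₅ (by simp); have d34 := hdist m₃ m₄ (by simp); have d35 := hdist m₃ m₅ (by simp)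
    have d45 := hdist m₄ m₅ (by simp)
    have dS : ∀ m, bxor m m₆ ∉ P → bxor m T ∉ P := by
      intro m hm6 hmS
      apply hm6
      have h := hPadd _ hmS _ hA'
      rwa [tbd_idA] at h
    have dS1 := dS m₁ (hdist m₁ m₆ (by simp)); have dS2 := dS m₂ (hdist m₂ m₆ (by simp)); have dS3 := dS m₃ (hdist m₃ m₆ (by simp))
    have dS4 := dS m₄ (hdist m₄ m₆ (by simp)); have dS5 := dS m₅ (hdist m₅ m₆ (by simp))
    have hpair' : ∀ a ∈ M', ∀ b ∈ M', a ≠ b → bxor a b ∉ P := by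
      intro a ha b hb hab
      simp only [hM', mem_insert, mem_singleton] at ha hb
      rcases ha with rfl | rfl | rfl | rfl | rfl | rfl <;> rcases hb with rfl | rfl | rfl | rfl | rfl | rfl <;>
        first
          | exact absurd rfl hab
          | assumption
          | (rw [bxor_comm]; assumption)
    have hcov' : ∀ x ∈ Z, ∃ a ∈ M', bxor a x ∈ P := by
      intro x hx
      rcases hcov x hx with h | h | h | h | h | h
      · exact ⟨m₁, by simp [hM'], h⟩
      · exact ⟨m₂, by simp [hM'], h⟩
      · exact ⟨m₃, by simp [hM'], h⟩
      · exact ⟨m₄, by simp [hM'], h⟩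
      · exact ⟨m₅, by simp [hM'], h⟩
      · refine ⟨T, by simp [hM'], ?_⟩
        have h' := hPadd _ hA' _ h
        rwa [tbd_idA] at h'
    have hZeq : Z = M'.biUnion (fun a => P.image (bxor a)) := by
      ext x
      constructor
      · intro hx
        obtain ⟨a, ha, hax⟩ := hcov' x hx
        exact mem_biUnion.2 ⟨a, ha, mem_image.2 ⟨bxor a x, hax, bxor_bxor_cancel_left a x⟩⟩
      · intro hx
        obtain ⟨a, ha, hx'⟩ := mem_biUnion.1 hx
        obtain ⟨p, hp, rfl⟩ := mem_image.1 hx'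
        exact hZst _ (hM'Z a ha) _ hp
    have hdisj : (M' : Set (Fin (6 + 6) → Bool)).PairwiseDisjoint (fun a => P.image (bxor a)) := by
      intro a ha b hb hab
      rw [Function.onFun, Finset.disjoint_left]
      intro x hxa hxb
      obtain ⟨p, hp, rfl⟩ := mem_image.1 hxa
      obtain ⟨q, hq, hq'⟩ := mem_image.1 hxb
      apply hpair' a ha b hb hab
      rw [tbd_idB a b p q hq']
      exact hPadd _ hp _ hq
    have hres : ∑ x, ((S x : ℤ) : ℝ) * twist x y = ∑ x ∈ Z, ((S x : ℤ) : ℝ) * twist x y := by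
      symm
      apply sum_subset (subset_univ Z)
      intro x _ hx
      rw [hoff0 x hx]; simp
    rw [hres, hZeq, sum_biUnion hdisj]
    refine tbd_sum_mul128 M' _ fun a ha => ?_
    rw [sum_image (fun p _ q _ h => by simpa using congrArg (bxor a) h)]
    obtain ⟨k, hk⟩ := tbd_coset_sum P hPadd β a (haff a ha) y
    refine ⟨k, ?_⟩
    rw [show (128 : ℝ) * k = (#P : ℝ) * k by rw [hP]; norm_num, ← hk]
    refine sum_congr rfl fun p hp => ?_
    rw [hβ _ (hZst _ (hM'Z a ha) _ hp)]
  · -- (ii) `Σ π² ≤ 254`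
    have hpt : ∀ x, (e x - S x) ^ 2 ≤ 2 * (e x ^ 2 - (if x ∈ Z then 1 else 0)) - (if x ∈ Z then 0 else e x ^ 2) := by
      intro x
      by_cases hx : x ∈ Z
      · rw [if_pos hx, if_pos hx, sub_zero, hβ x hx]
        have h4 : (4 : ℤ) ∣ e x - sZ (β x) := by rw [← hβ x hx]; exact hπ4 x
        exact tzc_pw_two (tp_sZ_cases (β x)) h4
      · rw [if_neg hx, if_neg hx, hoff0 x hx, sub_zero, sub_zero]
        nlinarith [sq_nonneg (e x)]
    have hindZ : ∑ x, (if x ∈ Z then (1 : ℤ) else 0) = 768 := by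
      rw [sum_boole]
      have : (univ.filter fun x => x ∈ Z) = Z := by ext x; simp
      rw [this, h768]; norm_num
    have hEoff : ∑ x, (if x ∈ Z then (0 : ℤ) else e x ^ 2) = ∑ x ∈ univ.filter (fun x => x ∉ Z), e x ^ 2 := by
      rw [← sum_filter_add_sum_filter_not univ (fun x => x ∈ Z)]
      have h1 : ∑ x ∈ univ.filter (fun x => x ∈ Z), (if x ∈ Z then (0 : ℤ) else e x ^ 2) = 0 :=
        sum_eq_zero fun x hx => by rw [if_pos (mem_filter.1 hx).2]
      rw [h1, zero_add]
      exact sum_congr rfl fun x hx => by rw [if_neg (mem_filter.1 hx).2]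
    have hsum := sum_le_sum fun x (_ : x ∈ (univ : Finset (Fin (6 + 6) → Bool))) => hpt x
    rw [sum_sub_distrib, ← mul_sum, sum_sub_distrib, hindZ, hEoff] at hsum
    rw [h768] at hoffle
    have hoffle' : ∑ x ∈ univ.filter (fun x => x ∉ Z), e x ^ 2 ≤ (∑ x, e x ^ 2) - 768 := by push_cast at hoffle; exact hoffle
    have hEnn : 0 ≤ ∑ x ∈ univ.filter (fun x => x ∉ Z), e x ^ 2 := sum_nonneg fun _ _ => sq_nonneg _
    show ∑ x, (e x - S x) ^ 2 ≤ 254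
    linarith

end Summit.QuantumAdvantage.QuantumAdvantage.Theorems.CubicForrelation.NearExactIsExact

end
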